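import Summits.CriticalPhenomena.PercolationContinuityZ3.Theorems.Transplant.BoxProdZ2ConcFace
import Summits.CriticalPhenomena.PercolationContinuityZ3.Theorems.Transplant.BoxProdZ2ConcRealised
import HarnessLib

/-!
# The face obligations `FaceOblC` of the concentric `X □ ℤ²` instance at the schedule `concRadiiGB C gap gap' E₀ L'` (design (D), §11 v2;
# residue (F), chosen-edge form; the run form follows by `faceOblR_of_faceOblC`): `faceOblAt_concG` at the REALISED anchors of a chosen edge
# (stmt-g5's `realised_of_choice`, `rE_real`, `rM_succ_real`, `ρ_real`, `rQ_real`), with the schedule condition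
# `gap ρ ≥ 2 L' + R₁(ρ)` (`R₁ ρ` an excess radius for entrance radius `ρ + 1`) and `ψ M ≤ E₀`

builds on p205010 (kernel theorem, internal audit signed; external expert review pending) — nothing in this file uses p205010.
Lane `prim-bschramm`, seat `prim-bschramm-p3` (residue (F) of V56); helper file (`--supports stmt-CriticalPhenomena-4575 --as helper`).

* **`faceOblC_concGB`** — `KSchA.FaceOblC X (concSchemeG X C w₀ (concRadiiGB C gap gap' E₀ L') q δc) (faceDataCG …) Δ' δ₂` from the kit
  machinery at `q`, the counts, `ψ M ≤ E₀`, `L_A + ψ M ≤ L'`, the level constants, an excess-radius FUNCTION `R₁` at `q` with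
  `2 L' + R₁ ρ ≤ gap ρ`, and the elongated deep routes `hroute` at the realised anchors (p2-g2's `advRoute_of_contact`).
[cite: KozmaNitzan2024, §4 p. 30 (Step III), Lemma 10 (p. 17), Lemma 12 (p. 24)]
-/

noncomputable section

open MeasureTheory

namespace Summit.CriticalPhenomena.PercolationContinuityZ3.Theorems

namespace Transplant

namespace BoxProdZ2

open Literature.Probability.Percolation Literature.Probability.LatticeModels SimpleGraph KNLevels KNCells GadgetSystem Contour
open Literature.Probability.Percolation.KozmaNitzan
open Literature.Probability.Percolation.KozmaNitzan.Cells (oth oth_ne sgOf sgOf_sign eq_oth_of_ne)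
open Literature.Probability.Percolation.GM
open Literature.Barriers.CriticalPhenomena (graphBall graphBall_finite mem_graphBall_self graphBall_mono)
open scoped Classical

variable {W : Type} [DecidableEq W] [Countable W] (X : SimpleGraph W) [X.LocallyFinite]

/-- **`FaceOblC` for the concentric instance at the schedule `concRadiiGB`** (chosen-edge form).  Per chosen valid `(h, e)`, onward `du`,
`j < K`, `o`: the anchors are realised (`realised_of_choice`), so with `g := nQ α x` the tube radius is `F (g+1)`, the true target radius
`F (g+1) - L'`, the entrance radius `E g + 1`; the schedule condition `2 L' + R₁ (E g) ≤ gap (E g)` (where `R₁ ρ` is an excess radius at `q`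
for entrances at fibre radius `ρ + 1`) gives `R₁ (E g) ≤ F (g+1) - 2 L'` and `L' ≤ F (g+1) - L'`.
[cite: KozmaNitzan2024, §4 p. 30 (Step III), Lemma 10 (p. 17), Lemma 12 (p. 24)] -/
theorem faceOblC_concGB (C : PCells) (w₀ : W) (gap gap' : ℕ → ℕ) (E₀ L' : ℕ) {q : unitInterval} {δc : ℝ}
    {Δ Δ' : ℕ} (hΔ : ∀ w, X.degree w ≤ Δ) {p₀ : unitInterval} (hT : TubeSubcritical X p₀) (V₀ : Finset W) {δ₂ : ℝ} (hδ₂ : 0 < δ₂)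
    {msel : W → ℕ} {M : ℕ} (hmsel : ∀ τ ∈ V₀, msel τ ≤ M)
    (hstd : ∀ τ ∈ V₀,
      1 - δ₂ ^ 2 < (bondPercolation (X □ zdGraph 2) q).real (UniqZone.zone (X □ zdGraph 2) (ufatSeq X hT V₀ τ) (msel τ) M) ∧
      ∀ g : HOct 2, 1 - δ₂ ^ 2 < (bondPercolation (X □ zdGraph 2) q).real
        (linkIn (↑(ufatSeq X hT V₀ τ M)) (ufatSeq X hT V₀ τ (msel τ)) (ballFin X τ (ufatRadius X hT V₀ M) ×ˢ piece g M)))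
    {L_A Rlev kk N : ℕ} (hψ : ufatRadius X hT V₀ M ≤ E₀) (hL : L_A + ufatRadius X hT V₀ M ≤ L') (hMR : M + 1 ≤ Rlev)
    (hRlev : Rlev + 3 ≤ 10 * C.s) (hRlev' : Rlev + 1 ≤ 3 * C.r)
    (hN : kk * kitB Δ M (ufatRadius X hT V₀ M) ≤ N) (hk : (1 - (q : ℝ) ^ kitSB Δ M (ufatRadius X hT V₀ M)) ^ kk ≤ δ₂)
    (hcount : 1 / (1 - (q : ℝ)) ^ (Δ' * N) ≤ δ₂ * ((Finset.Icc (M + 1) Rlev).card : ℝ))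
    {η : ℝ} (hη : η ≤ δc / 2) (R₁ : ℕ → ℕ)
    (hR₁ : ∀ ρ R', R₁ ρ ≤ R' → ∀ τ ∈ ({w₀} : Finset W), ∀ (Rw : ℕ) (D' A' : Finset (W × Site 2)), D' ⊆ ballFin X τ Rw ×ˢ box 2 (25 * C.r) →
      A' ⊆ D' → (∀ v ∈ A', v.1 ∈ ballFin X τ (ρ + 1)) → (bondPercolation (X □ zdGraph 2) q).real (excess X τ R' D' A') ≤ η)
    (hgap : ∀ ρ, 2 * L' + R₁ ρ ≤ gap ρ)
    (hroute : ∀ (h : ProbeHistory (W × Site 2)) (e : Site 2 × MDir),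
      ((concSchemeG X C w₀ (concRadiiGB C gap gap' E₀ L') q δc).astOf₂ (X □ zdGraph 2) h).st.choice = some e →
      (concSchemeG X C w₀ (concRadiiGB C gap gap' E₀ L') q δc).Valid₂ (X □ zdGraph 2) h e →
      ∀ du ∈ (concSchemeG X C w₀ (concRadiiGB C gap gap' E₀ L') q δc).onward (X □ zdGraph 2) h (tgt e), ∀ j < C.K,
      ∀ (o : Finset (Sym2 (W × Site 2))),
      let Λ := concRadiiGB C gap gap' E₀ L'
      let S := concSchemeG X C w₀ Λ q δc
      let a := S.aOf₁ (X □ zdGraph 2) h e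
      let a' := S.aOf₂ (X □ zdGraph 2) h e
      let P := faceStep X C w₀ Λ a' (tgt e) du j Rlev N M L' (S.Sx (X □ zdGraph 2) h e a a' du)
      ∀ j', M + 1 ≤ j' → j' ≤ Rlev → ∀ x' ∈ outerBoundary (tubeGraph X P.π) (tubeLevel P.π P.lo P.hi j'),
        ballFin X (fibCtrT X w₀ (Λ.rE a' (tgt e) du) (ufatRadius X hT V₀ M) x'.1) L_A ⊆ ballFin X w₀ (Λ.rM a' (tgt e + stepVec du)) →
        ∃ (γ : X ≃g X) (Qt Ft : Finset (W × Site 2)), γ (fibCtrT X w₀ (Λ.rE a' (tgt e) du) (ufatRadius X hT V₀ M) x'.1) ∈ V₀ ∧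
          Ft ⊆ P.T ∧ Qt ⊆ P.Rg ∧
          Disjoint Ft (kitCube X w₀ (Λ.rE a' (tgt e) du) (P.lo - ((j' : ℕ) : Site 2)) (P.hi + ((j' : ℕ) : Site 2)) M (ufatRadius X hT V₀ M) x') ∧
          1 - δ₂ ^ 2 < (prodBernoulli (S.Wt (X □ zdGraph 2) h e a a' du j o)).real (linkIn (↑Qt)
            (frameSeq X hT V₀ γ (vctr (P.lo - ((j' : ℕ) : Site 2)) (P.hi + ((j' : ℕ) : Site 2)) M
              (pwin (P.lo - ((j' : ℕ) : Site 2)) (P.hi + ((j' : ℕ) : Site 2)) M x'.2).1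
              (pwin (P.lo - ((j' : ℕ) : Site 2)) (P.hi + ((j' : ℕ) : Site 2)) M x'.2).2.1
              (pwin (P.lo - ((j' : ℕ) : Site 2)) (P.hi + ((j' : ℕ) : Site 2)) M x'.2).2.2)
              (γ (fibCtrT X w₀ (Λ.rE a' (tgt e) du) (ufatRadius X hT V₀ M) x'.1))
              (msel (γ (fibCtrT X w₀ (Λ.rE a' (tgt e) du) (ufatRadius X hT V₀ M) x'.1)))) Ft)) :
    KSchA.FaceOblC X (concSchemeG X C w₀ (concRadiiGB C gap gap' E₀ L') q δc) (faceDataCG X C w₀ (concRadiiGB C gap gap' E₀ L')) Δ' δ₂ := by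
  intro h e hc hV du hdu j hj o
  set Λ := concRadiiGB C gap gap' E₀ L' with hΛdef
  set S := concSchemeG X C w₀ Λ q δc with hS
  have hr := realised_of_choice h hc
  have hy : tgt e + stepVec du ≠ 0 := tgt_add_stepVec_ne_zero hV hdu
  set g := nQ (S.aOf₁ (X □ zdGraph 2) h e) (tgt e) with hg
  -- the realised radii
  have hrE : Λ.rE (S.aOf₂ (X □ zdGraph 2) h e) (tgt e) du = Frad gap gap' E₀ (g + 1) := rE_real C gap gap' E₀ L' hr hy
  have hrM : Λ.rM (S.aOf₂ (X □ zdGraph 2) h e) (tgt e + stepVec du) = Frad gap gap' E₀ (g + 1) - L' := rM_succ_real C gap gap' E₀ L' hr hy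
  have hF : Frad gap gap' E₀ (g + 1) = Erad gap gap' E₀ g + gap (Erad gap gap' E₀ g) := Frad_succ gap gap' E₀ g
  have hE₀ : E₀ ≤ Erad gap gap' E₀ g := by simpa using Erad_mono gap gap' E₀ (Nat.zero_le g)
  have hgapg := hgap (Erad gap gap' E₀ g)
  have hjK : j + 1 ≤ C.K := hj
  refine faceOblAt_concG X (concRadiiGB_WF C gap gap' E₀ L') hV hdu hjK hΔ hT V₀ hδ₂ hmsel hstd (L_A := L_A) (L' := L') ?_ hL ?_ hMR
    hRlev hRlev' hN hk hcount (hroute h e hc hV du hdu j hj o) (R₀ := Erad gap gap' E₀ g) ?_ le_rfl ?_ hη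
    (hR₁ (Erad gap gap' E₀ g)) ?_
  · -- `ψ M ≤ R = F (g+1)`
    rw [hrE, hF]; omega
  · -- `L' ≤ Rt = F (g+1) - L'`
    rw [hrM, hF]; omega
  · -- `rB_a(e) ≤ E g`
    rw [concRadiiGB_rB, concRadiiGB_rE]; exact min_le_right _ _
  · -- the stub profile is `E g`
    intro ℓ; exact (ρ_real C gap gap' E₀ L' hr hy ℓ).le
  · -- `R₁ (E g) ≤ Rt - L'`
    rw [hrM, hF]; omega

end BoxProdZ2

end Transplant

end Summit.CriticalPhenomena.PercolationContinuityZ3.Theorems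

end
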